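import Mathlib.AlgebraicGeometry.EllipticCurve.Affine.Point
import Mathlib.Topology.Instances.Real.Lemmas
import Mathlib.Order.Filter.AtTopBot.Basic
import Mathlib.Algebra.Order.BigOperators.Ring.Finset
import Literature.NumberTheory.EllipticCurves.MordellWeil
import HarnessLib

/-!
# Bhargava–Ho 2022: the family `F₂` of elliptic curves with two marked points, its height, large subfamilies, and the independence of the marked points for 100 % of the family

Topic `Literature/NumberTheory/EllipticCurves`, cluster `BhargavaHo2022`. VOCABULARY (definitions
with bodies) + ONE named fact + small API; nothing else asserted. HONEST FRAMING (cell `bsd-rank2`,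
D-0036; director-bsd ruling 2026-08-26T01:56Z registering the TWIN-axis rung leaf
`PAdicBSDRankTwoPositiveProportion` for the «counting door» of the lane p2, memo
`HOME/p2/PADIC-R2-G8.md` §3): this file supplies the Literature-side objects that leaf is stated
over — the family `F₂`, Bhargava–Ho's height, «large» congruence subfamilies, averages / densities
along the height — in the shape of the tree's template for the family of ALL curves
(`Literature.NumberTheory.EllipticCurves.shortWeierstrass`, `naiveHeight`, `heightFamilyBelow`,
`heightAverage`, file `HeightFamily.lean`; `CongruenceFamily`, `IsLarge`, `heightAverageOn`, file
`BSDRankZeroDensity.lean`). It proves nothing about BSD and reads no analytic rank.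

**Source** (held, `paper:arxiv-2207.03309`, LaTeX text; page = chunk): M. Bhargava, W. Ho, *On
average sizes of Selmer groups and ranks in families of elliptic curves having marked points*,
arXiv:2207.03309 (2022) [BhargavaHo2022].
* §1 (p0002 L3–L20): "`F₂ = {y² + a₁xy + a₃y = (x - a₂)(x - a₂')(x - a₂'') | a₁, a₂, a₂', a₂'',
  a₃ ∈ ℤ, a₂ + a₂' + a₂'' = 0, Δ ≠ 0}`, where, in each case, `Δ` is the discriminant polynomial
  in the coefficients `a_i, a_i', a_i''` whose nonvanishing is equivalent to the curve being
  nonsingular. … `F₂` is the family of all elliptic curves with two marked rational points (at,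
  e.g., `(a₂, 0)` and `(a₂', 0)`)."
* §1 (p0002 L25): "define the (naive) height of an elliptic curve `E` in the family `F₂` by
  `H(E) := max{|a_i|^{12/i}, |a₂'|⁶, |a₂''|⁶}`."
* §1 (p0002 L66–L72): "let `Φ` be any subfamily of `F` that is defined, for each prime `p`, by
  congruence conditions modulo some power of `p`. We say that such a subfamily `Φ` of elliptic
  curves over `ℚ` is large at `p` if the congruence conditions defining `Φ` at `p` contains all
  elliptic curves `E` in the family such that `p²` does not divide the reduced discriminant
  `Δ_red(E)` of `E`; and we say that the subfamily `Φ` of `F` is large if it is large at all but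
  finitely many primes `p`. The reduced discriminant `Δ_red` is the polynomial that is the
  squarefree part of the discriminant polynomial `Δ`." For `F₂` the discriminant polynomial
  `Δ(a₁, a₂, a₂', a₃)` is IRREDUCIBLE over `ℚ` (weighted-homogeneous of weight 12 for the weights
  (1, 2, 2, 3); 35 monomials; content 1 up to sign — cell bsd-rank2, kit job j248539), so
  `Δ_red = ±Δ` and "`p² ∤ Δ_red(E)`" is "`p² ∤ Δ(E)`" (`CongruenceFamily₂.IsLargeAt`).
* §10, Thm. 10.1 (p0035 L5–L9): "Let `j ∈ {1,2}` and `d` any positive integer. For an elliptic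
  curve `E ∈ F_j`, let `S(E)` denote the `d`-Selmer group of `E ∈ F_j` and `S'(E)` the subgroup in
  `S(E)` generated by the images of the marked points on `E`. Then, when elliptic curves `E ∈ F_j`
  are ordered by height, 100% of these curves `E` have the property that `|S'(E)| = d^j`.
  Theorem 10.1 implies that, for 100% of the curves `E` in `F_j`, the subgroup in `E(ℚ)` generated
  by the marked points has rank `j`. Thus, when elliptic curves `E ∈ F_j` are ordered by height,
  100% of these curves `E` have rank at least `j`." and (proof, p0035 L13): "asympotically 100%
  of the elliptic curves in `F_j` have trivial rational torsion" (Hilbert irreducibility + Mazur).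

## Contents

* `Params` (the integer parameters `a₁, a₂, a₂', a₃`; `a₂'' := -a₂ - a₂'`), `Params.curveInt`,
  `Params.curve : WeierstrassCurve ℚ` = `[a₁, 0, a₃, -(a₂² + a₂a₂' + a₂'²), a₂a₂'(a₂ + a₂')]`, with
  `Params.equation_curve_iff` (PROVED: this IS `y² + a₁xy + a₃y = (x - a₂)(x - a₂')(x + a₂ + a₂')`),
  `Params.IsMember` (`Δ ≠ 0`), `Params.isElliptic_curve`, the marked points `Params.markedPoint₁`
  (`(a₂, 0)`), `Params.markedPoint₂` (`(a₂', 0)`) as `Affine.Point`s (PROVED on the curve).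
* `Params.height` (Bhargava–Ho's height, as an integer: `max(|a₁|¹², |a₂|⁶, |a₂'|⁶, |a₂ + a₂'|⁶,
  |a₃|⁴)`), `below X : Finset Params` (members of height `< X`) with `mem_below_iff` (PROVED).
* `CongruenceFamily₂` (a subfamily defined by congruence conditions modulo `p ^ expt p` at each
  prime), `Mem`, `IsLargeAt`, `IsLarge`, the whole family `CongruenceFamily₂.all` (`isLarge_all`,
  PROVED).
* `averageOn Φ f X`, `proportionOn Φ P X`, and the ε-forms `AverageOnLE` (limsup ≤ c),
  `DensityOnGE` (liminf ≥ δ), `HasPositiveLowerDensityOn` (liminf > 0, witnessed), `HasDensityOn`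
  (limit) — the tree's `HeightAverageLE` / `HeightDensityGE` / `HasHeightDensity` shapes.
* ONE named fact `thm10_1_F2` (Thm. 10.1 for `F₂` in its printed Mordell–Weil corollary form + the
  trivial-torsion sentence of its proof): 100 % of `F₂` by height have trivial rational torsion, and
  100 % have `rank E(ℚ) ≥ 2`; with the PROVED corollary `thm10_1_F2.hasDensityOn_and` (both jointly
  for 100 %, by inclusion–exclusion on the proportions).

Not transcribed here (no consumer yet; each would be a further named fact): Thm. 1.1/1.2 for `F₂`
("The average size of the 2-Selmer group in `F₂` is at most 12", also over large subfamilies),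
Thm. 1.3 (average rank / positive proportion of rank 2), Thm. 3.1 line 7 (hypercubes
`2 ⊗ 2 ⊗ 2 ⊗ 2` parametrize 2-Selmer elements of `F₂`).
-- TODO(general form): Thm. 10.1 is printed for every `d` as `|S'(E)| = d^j` (Selmer image of the
-- marked points); only its printed Mordell–Weil corollary and the torsion sentence are vendored.
-- The `ℤ`-independence of the two marked points THEMSELVES is not stated here: the group law on
-- `E(ℚ)` is elaborated in the tree against the classical `DecidableEq` (see `MordellWeil.lean`), and
-- this vocabulary file declares no local instances; consumers state it in their own files.

References: [BhargavaHo2022] §1 (p0002), Thm. 10.1 and its proof (p0035); [BhargavaHo2016]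
M. Bhargava, W. Ho, *Coregular spaces and genus one curves*, Camb. J. Math. 4 (2016) 1–119, §1
(the space of `2×2×2×2` hypercubes and the curve through `P`, `P'`); the tree's
`HeightFamily.lean`, `BSDRankZeroDensity.lean` (templates), `MordellWeil.lean` (`mordellWeilRank`, `torsionOrder`).
-/

open Filter Topology

namespace Literature.NumberTheory.EllipticCurves.BhargavaHo2022

/-! ### The parameters and the curve -/

/-- The integer parameters `(a₁, a₂, a₂', a₃)` of a member
`y² + a₁xy + a₃y = (x - a₂)(x - a₂')(x - a₂'')`, `a₂'' = -a₂ - a₂'`, of Bhargava–Ho's family `F₂`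
(the fifth printed parameter `a₂''` is eliminated by `a₂ + a₂' + a₂'' = 0`).
[cite: BhargavaHo2022, §1 (definition of F₂)] -/
structure Params where
  /-- coefficient of `xy` -/
  a₁ : ℤ
  /-- first marked root: the marked point `(a₂, 0)` -/
  a₂ : ℤ
  /-- second marked root: the marked point `(a₂', 0)` -/
  a₂' : ℤ
  /-- coefficient of `y` -/
  a₃ : ℤ

namespace Params

variable (a : Params)

/-- The third root `a₂'' = -a₂ - a₂'` ("`a₂ + a₂' + a₂'' = 0`"). [cite: BhargavaHo2022, §1 (definition of F₂)] -/
def a₂'' : ℤ := -a.a₂ - a.a₂'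

/-- The member of `F₂` with parameters `a`, as an integral Weierstrass curve: expanding
`(x - a₂)(x - a₂')(x + a₂ + a₂') = x³ - (a₂² + a₂a₂' + a₂'²)x + a₂a₂'(a₂ + a₂')` gives the
Weierstrass coefficients `[a₁, 0, a₃, -(a₂² + a₂a₂' + a₂'²), a₂a₂'(a₂ + a₂')]`.
[cite: BhargavaHo2022, §1 (definition of F₂)] -/
def curveInt : WeierstrassCurve ℤ :=
  ⟨a.a₁, 0, a.a₃, -(a.a₂ ^ 2 + a.a₂ * a.a₂' + a.a₂' ^ 2), a.a₂ * a.a₂' * (a.a₂ + a.a₂')⟩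

/-- The member of `F₂` with parameters `a`, as a Weierstrass curve over `ℚ` (base change of
`curveInt`). [cite: BhargavaHo2022, §1 (definition of F₂)] -/
def curve : WeierstrassCurve ℚ :=
  a.curveInt.map (Int.castRingHom ℚ)

/-- The Weierstrass coefficients of `curve a`, spelled out. [cite: BhargavaHo2022, §1 (definition of F₂)] -/
theorem curve_eq : a.curve = ⟨(a.a₁ : ℚ), 0, (a.a₃ : ℚ),
    -((a.a₂ : ℚ) ^ 2 + a.a₂ * a.a₂' + (a.a₂' : ℚ) ^ 2), (a.a₂ : ℚ) * a.a₂' * (a.a₂ + a.a₂')⟩ := by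
  simp [curve, curveInt, WeierstrassCurve.map]

/-- **The defining equation.** A point `(x, y)` lies on `curve a` iff
`y² + a₁xy + a₃y = (x - a₂)(x - a₂')(x + a₂ + a₂')` — Bhargava–Ho's equation of `F₂` with
`a₂'' = -a₂ - a₂'`. [cite: BhargavaHo2022, §1 (definition of F₂)] -/
theorem equation_curve_iff (x y : ℚ) : a.curve.toAffine.Equation x y ↔
    y ^ 2 + a.a₁ * x * y + a.a₃ * y = (x - a.a₂) * (x - a.a₂') * (x + a.a₂ + a.a₂') := by
  rw [WeierstrassCurve.Affine.equation_iff, curve_eq]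
  constructor <;> intro h <;> linear_combination h

/-- The discriminant of `curve a` is the (integer) discriminant polynomial of `F₂` evaluated at `a`.
[cite: BhargavaHo2022, §1 (the discriminant polynomial Δ)] -/
theorem curve_Δ : a.curve.Δ = (a.curveInt.Δ : ℚ) := by
  rw [curve, WeierstrassCurve.map_Δ]
  rfl

/-- Membership in `F₂`: "`Δ ≠ 0`" (the curve is nonsingular). [cite: BhargavaHo2022, §1 (definition of F₂)] -/
def IsMember (a : Params) : Prop := a.curveInt.Δ ≠ 0

variable {a} in
/-- A member of `F₂` is an elliptic curve. [cite: BhargavaHo2022, §1 (definition of F₂)] -/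
theorem isElliptic_curve (h : a.IsMember) : a.curve.IsElliptic :=
  ⟨Ne.isUnit (by rw [curve_Δ]; exact_mod_cast h)⟩

/-- The first marked point `(a₂, 0)` lies on the curve. [cite: BhargavaHo2022, §1 (F₂: marked point (a₂, 0))] -/
theorem equation_markedPoint₁ : a.curve.toAffine.Equation (a.a₂ : ℚ) 0 := by
  rw [equation_curve_iff]
  ring

/-- The second marked point `(a₂', 0)` lies on the curve. [cite: BhargavaHo2022, §1 (F₂: marked point (a₂', 0))] -/
theorem equation_markedPoint₂ : a.curve.toAffine.Equation (a.a₂' : ℚ) 0 := by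
  rw [equation_curve_iff]
  ring

/-- The third root `(a₂'', 0) = (-a₂ - a₂', 0)` lies on the curve (it is `-(P₁ + P₂)` in the group
law, the three roots being collinear on `y = 0`). [cite: BhargavaHo2022, §1 (definition of F₂)] -/
theorem equation_thirdRoot : a.curve.toAffine.Equation (a.a₂'' : ℚ) 0 := by
  rw [equation_curve_iff, a₂'']
  push_cast
  ring

variable {a} in
/-- The first marked point `P₁ = (a₂, 0) ∈ E(ℚ)` of a member of `F₂` (nonsingular because `Δ ≠ 0`,
Mathlib `equation_iff_nonsingular_of_Δ_ne_zero`). [cite: BhargavaHo2022, §1 (F₂: marked point (a₂, 0))] -/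
def markedPoint₁ (h : a.IsMember) : a.curve.toAffine.Point :=
  .some _ _ ((WeierstrassCurve.Affine.equation_iff_nonsingular_of_Δ_ne_zero
    (by rw [curve_Δ]; exact_mod_cast h)).mp a.equation_markedPoint₁)

variable {a} in
/-- The second marked point `P₂ = (a₂', 0) ∈ E(ℚ)` of a member of `F₂`.
[cite: BhargavaHo2022, §1 (F₂: marked point (a₂', 0))] -/
def markedPoint₂ (h : a.IsMember) : a.curve.toAffine.Point :=
  .some _ _ ((WeierstrassCurve.Affine.equation_iff_nonsingular_of_Δ_ne_zero
    (by rw [curve_Δ]; exact_mod_cast h)).mp a.equation_markedPoint₂)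

/-! ### The height and the finite sets of members of bounded height -/

/-- **Bhargava–Ho's (naive) height on `F₂`**, "`H(E) := max{|a_i|^{12/i}, |a₂'|⁶, |a₂''|⁶}`", as an
integer: `max(|a₁|¹², |a₂|⁶, |a₂'|⁶, |a₂''|⁶, |a₃|⁴)` with `|a₂''| = |a₂ + a₂'|`.
[cite: BhargavaHo2022, §1 (definition of the height on F₂, before Thm. 1.1)] -/
def height : ℤ :=
  max (max (max (max (|a.a₁| ^ 12) (|a.a₂| ^ 6)) (|a.a₂'| ^ 6)) (|a.a₂ + a.a₂'| ^ 6)) (|a.a₃| ^ 4)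

/-- The height is nonnegative. [cite: BhargavaHo2022, §1 (definition of the height on F₂)] -/
theorem height_nonneg : 0 ≤ a.height :=
  le_max_of_le_right (pow_nonneg (abs_nonneg _) 4)

/-- The parameter tuple as an element of `ℤ⁴` (for counting in boxes). [cite: BhargavaHo2022, §1 (definition of F₂)] -/
def ofTuple (t : ℤ × ℤ × ℤ × ℤ) : Params := ⟨t.1, t.2.1, t.2.2.1, t.2.2.2⟩

/-- `ofTuple` is injective. [cite: BhargavaHo2022, §1 (definition of F₂)] -/
theorem ofTuple_injective : Function.Injective ofTuple := by
  rintro ⟨t₁, t₂, t₃, t₄⟩ ⟨s₁, s₂, s₃, s₄⟩ h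
  simp only [ofTuple, Params.mk.injEq] at h
  obtain ⟨rfl, rfl, rfl, rfl⟩ := h
  rfl

end Params

/-- An integer whose `n`-th power (`n ≠ 0`) is at most `X` has absolute value at most `X`
(`|t| ≤ |t|ⁿ` for `|t| ≥ 1`). [folklore] -/
private theorem abs_le_of_abs_pow_le {t X : ℤ} {n : ℕ} (hn : n ≠ 0) (hX : 0 ≤ X)
    (h : |t| ^ n ≤ X) : |t| ≤ X := by
  rcases (abs_nonneg t).eq_or_lt with h0 | hpos
  · rw [← h0]; exact hX
  · exact (le_self_pow₀ (by omega) hn).trans h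

/-- **The members of `F₂` of height `< X`**, as a finite set: the parameters `a` in the box
`[-X, X]⁴` with `Δ(a) ≠ 0` and `height a < X` (the box condition is redundant, `mem_below_iff`).
[cite: BhargavaHo2022, §1 ("when elliptic curves in the family F₂ are ordered by height")] -/
noncomputable def below (X : ℕ) : Finset Params := by
  classical
  exact ((Finset.Icc (-(X : ℤ)) X ×ˢ Finset.Icc (-(X : ℤ)) X ×ˢ Finset.Icc (-(X : ℤ)) X ×ˢ
      Finset.Icc (-(X : ℤ)) X).map ⟨Params.ofTuple, Params.ofTuple_injective⟩).filter
    fun a ↦ a.IsMember ∧ a.height < X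

/-- Membership in `below X`: exactly the members of `F₂` of height `< X` (the box is implied:
`height a < X` forces `|a₁|, |a₂|, |a₂'|, |a₃| ≤ X`). [cite: BhargavaHo2022, §1 (height on F₂)] -/
theorem mem_below_iff (a : Params) (X : ℕ) : a ∈ below X ↔ a.IsMember ∧ a.height < X := by
  classical
  simp only [below, Finset.mem_filter, Finset.mem_map, Finset.mem_product, Finset.mem_Icc,
    Function.Embedding.coeFn_mk, and_iff_right_iff_imp, and_imp]
  intro _ hH
  have hX : (0 : ℤ) ≤ X := by positivity
  have hle : a.height ≤ X := hH.le
  have h1 : |a.a₁| ≤ X := abs_le_of_abs_pow_le (n := 12) (by norm_num) hX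
    ((le_max_left _ _).trans ((le_max_left _ _).trans ((le_max_left _ _).trans
      ((le_max_left _ _).trans hle))))
  have h2 : |a.a₂| ≤ X := abs_le_of_abs_pow_le (n := 6) (by norm_num) hX
    ((le_max_right _ _).trans ((le_max_left _ _).trans ((le_max_left _ _).trans
      ((le_max_left _ _).trans hle))))
  have h3 : |a.a₂'| ≤ X := abs_le_of_abs_pow_le (n := 6) (by norm_num) hX
    ((le_max_right _ _).trans ((le_max_left _ _).trans ((le_max_left _ _).trans hle)))
  have h4 : |a.a₃| ≤ X := abs_le_of_abs_pow_le (n := 4) (by norm_num) hX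
    ((le_max_right _ _).trans hle)
  refine ⟨(a.a₁, a.a₂, a.a₂', a.a₃), ⟨abs_le.mp h1, abs_le.mp h2, abs_le.mp h3, abs_le.mp h4⟩, ?_⟩
  cases a
  rfl

/-- `below` is monotone in the height bound. [cite: BhargavaHo2022, §1 (height on F₂)] -/
theorem below_mono : Monotone below := by
  intro X Y hXY a
  simp only [mem_below_iff]
  rintro ⟨h, hlt⟩
  exact ⟨h, lt_of_lt_of_le hlt (by exact_mod_cast hXY)⟩

/-! ### Subfamilies defined by congruence conditions; large subfamilies -/

/-- Data of **a subfamily `Φ` of `F₂` defined, for each prime `p`, by congruence conditions modulo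
some power of `p`**: at the prime `p` the condition is membership of the residue of
`(a₁, a₂, a₂', a₃)` modulo `p ^ expt p` in `residues p` (the shape of the tree's
`Literature.NumberTheory.EllipticCurves.CongruenceFamily` for the family of all curves).
[cite: BhargavaHo2022, §1 (before Thm. 1.2: subfamilies defined by congruence conditions)] -/
structure CongruenceFamily₂ where
  /-- the exponent `k_p` of the modulus `p ^ k_p` of the local condition at the prime `p` -/
  expt : ℕ → ℕ
  /-- the allowed residues `(a₁, a₂, a₂', a₃) mod p ^ k_p` at the prime `p` -/
  residues : (p : ℕ) →
    Set (ZMod (p ^ expt p) × ZMod (p ^ expt p) × ZMod (p ^ expt p) × ZMod (p ^ expt p))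

namespace CongruenceFamily₂

variable (Φ : CongruenceFamily₂)

/-- The residue of the parameters `a` modulo `p ^ expt p`. [cite: BhargavaHo2022, §1 (subfamilies defined by congruence conditions)] -/
def residueOf (p : ℕ) (a : Params) :
    ZMod (p ^ Φ.expt p) × ZMod (p ^ Φ.expt p) × ZMod (p ^ Φ.expt p) × ZMod (p ^ Φ.expt p) :=
  ((a.a₁ : ZMod (p ^ Φ.expt p)), (a.a₂ : ZMod (p ^ Φ.expt p)), (a.a₂' : ZMod (p ^ Φ.expt p)),
    (a.a₃ : ZMod (p ^ Φ.expt p)))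

/-- Membership of the member with parameters `a` in the subfamily `Φ`: `Δ(a) ≠ 0` and the residue
condition at every prime. [cite: BhargavaHo2022, §1 (subfamilies defined by congruence conditions)] -/
def Mem (Φ : CongruenceFamily₂) (a : Params) : Prop :=
  a.IsMember ∧ ∀ p : ℕ, p.Prime → Φ.residueOf p a ∈ Φ.residues p

/-- **`Φ` is large at `p`**: "the congruence conditions defining `Φ` at `p` contains all elliptic
curves `E` in the family such that `p²` does not divide the reduced discriminant `Δ_red(E)`"; for
`F₂`, `Δ_red = ±Δ` (the discriminant polynomial of `F₂` is irreducible), so the condition reads: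
every member with `p² ∤ Δ(a)` satisfies the residue condition at `p`.
[cite: BhargavaHo2022, §1 (definition of "large at p", before Thm. 1.2)] -/
def IsLargeAt (Φ : CongruenceFamily₂) (p : ℕ) : Prop :=
  ∀ a : Params, a.IsMember → ¬ ((p : ℤ) ^ 2 ∣ a.curveInt.Δ) → Φ.residueOf p a ∈ Φ.residues p

/-- **`Φ` is large**: "large at all but finitely many primes `p`".
[cite: BhargavaHo2022, §1 (definition of "large", before Thm. 1.2)] -/
def IsLarge (Φ : CongruenceFamily₂) : Prop :=
  ∃ p₀ : ℕ, ∀ p : ℕ, p₀ ≤ p → p.Prime → Φ.IsLargeAt p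

/-- The whole family `F₂` (no congruence condition at any prime).
[cite: BhargavaHo2022, §1 ("the sets of all curves … in F₂ are large")] -/
def all : CongruenceFamily₂ :=
  ⟨fun _ ↦ 0, fun _ ↦ Set.univ⟩

/-- Membership in the whole family is membership in `F₂`. [cite: BhargavaHo2022, §1 (definition of F₂)] -/
theorem mem_all_iff (a : Params) : all.Mem a ↔ a.IsMember :=
  ⟨fun h ↦ h.1, fun h ↦ ⟨h, fun _ _ ↦ Set.mem_univ _⟩⟩

/-- "the sets of all curves … in … `F₂` are large." [cite: BhargavaHo2022, §1 (after Thm. 1.2)] -/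
theorem isLarge_all : all.IsLarge :=
  ⟨0, fun _ _ _ _ _ _ ↦ Set.mem_univ _⟩

/-! ### Averages, proportions and densities over a subfamily, ordered by height -/

/-- The members of `Φ` of height `< X`. [cite: BhargavaHo2022, §1 (ordering by height; Thm. 1.2)] -/
noncomputable def below (X : ℕ) : Finset Params := by
  classical
  exact (BhargavaHo2022.below X).filter Φ.Mem

/-- Membership in `Φ.below X`. [cite: BhargavaHo2022, §1 (ordering by height; Thm. 1.2)] -/
theorem mem_below_iff (a : Params) (X : ℕ) : a ∈ Φ.below X ↔ Φ.Mem a ∧ a.height < X := by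
  classical
  simp only [below, Finset.mem_filter, BhargavaHo2022.mem_below_iff, Mem]
  tauto

/-- **The average of a real-valued invariant `f` over the members of `Φ` of height `< X`** (the
shape "the average size of the `2`-Selmer group in `F₂`", "when one averages over any large
subfamily"; junk value `0` when no member has height `< X`).
[cite: BhargavaHo2022, Thm. 1.1 and Thm. 1.2 (averages over F₂ and over large subfamilies)] -/
noncomputable def averageOn (f : Params → ℝ) (X : ℕ) : ℝ :=
  (∑ a ∈ Φ.below X, f a) / (Φ.below X).card

/-- The proportion of members of `Φ` of height `< X` satisfying `P` (the average of the indicator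
of `P`). [cite: BhargavaHo2022, Thm. 10.1 ("100% of these curves", ordered by height)] -/
noncomputable def proportionOn (P : Params → Prop) (X : ℕ) : ℝ := by
  classical
  exact Φ.averageOn (fun a ↦ if P a then 1 else 0) X

/-- `AverageOnLE Φ f c`: `limsup_{X → ∞}` of the average of `f` over `Φ` is at most `c`, in the
tree's ε-form (no `Filter.limsup`): for every `ε > 0`, eventually the average is `≤ c + ε` — the
shape of "the average size of … is at most 12". [cite: BhargavaHo2022, Thm. 1.1 (shape of the statement)] -/
def AverageOnLE (Φ : CongruenceFamily₂) (f : Params → ℝ) (c : ℝ) : Prop :=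
  ∀ ε : ℝ, 0 < ε → ∀ᶠ X : ℕ in atTop, Φ.averageOn f X ≤ c + ε

/-- `DensityOnGE Φ P δ`: `liminf_{X → ∞}` of the proportion of members of `Φ` satisfying `P` is at
least `δ` (ε-form). [cite: BhargavaHo2022, Thm. 1.3 (shape: "a positive proportion")] -/
def DensityOnGE (Φ : CongruenceFamily₂) (P : Params → Prop) (δ : ℝ) : Prop :=
  ∀ ε : ℝ, 0 < ε → ∀ᶠ X : ℕ in atTop, δ - ε ≤ Φ.proportionOn P X

/-- `HasPositiveLowerDensityOn Φ P`: a positive proportion (positive lower density, with an explicit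
witness `δ > 0`) of the members of `Φ`, ordered by height, satisfy `P`.
[cite: BhargavaHo2022, Thm. 1.3 (shape: "a positive proportion of elliptic curves in F₂")] -/
def HasPositiveLowerDensityOn (Φ : CongruenceFamily₂) (P : Params → Prop) : Prop :=
  ∃ δ : ℝ, 0 < δ ∧ ∀ᶠ X : ℕ in atTop, δ ≤ Φ.proportionOn P X

/-- `HasDensityOn Φ P δ`: the proportion of members of `Φ` of height `< X` satisfying `P` tends to
`δ`; "100% of these curves" is `HasDensityOn Φ P 1`. [cite: BhargavaHo2022, Thm. 10.1 ("100%")] -/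
def HasDensityOn (Φ : CongruenceFamily₂) (P : Params → Prop) (δ : ℝ) : Prop :=
  Tendsto (Φ.proportionOn P) atTop (𝓝 δ)

/-! ### API: proportions lie in `[0, 1]`; two density-one properties hold jointly for 100 % -/

/-- A proportion is nonnegative. [folklore] -/
private theorem proportionOn_nonneg (P : Params → Prop) (X : ℕ) : 0 ≤ Φ.proportionOn P X := by
  classical
  unfold proportionOn averageOn
  exact div_nonneg (Finset.sum_nonneg fun _ _ ↦ by split_ifs <;> norm_num) (Nat.cast_nonneg _)

/-- A proportion is at most `1`. [folklore] -/
private theorem proportionOn_le_one (P : Params → Prop) (X : ℕ) : Φ.proportionOn P X ≤ 1 := by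
  classical
  unfold proportionOn averageOn
  rcases Nat.eq_zero_or_pos (Φ.below X).card with h0 | hpos
  · rw [h0, Nat.cast_zero, div_zero]; exact zero_le_one
  · rw [div_le_one (by exact_mod_cast hpos)]
    calc (∑ a ∈ Φ.below X, (if P a then (1 : ℝ) else 0))
        ≤ ∑ _a ∈ Φ.below X, (1 : ℝ) :=
          Finset.sum_le_sum fun _ _ ↦ by split_ifs <;> norm_num
      _ = (Φ.below X).card := by simp

/-- Inclusion–exclusion for indicators: `prop(P) + prop(Q) ≤ 1 + prop(P ∧ Q)` over any height ball.
[folklore] -/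
private theorem proportionOn_add_le (P Q : Params → Prop) (X : ℕ) :
    Φ.proportionOn P X + Φ.proportionOn Q X ≤ 1 + Φ.proportionOn (fun a ↦ P a ∧ Q a) X := by
  classical
  unfold proportionOn averageOn
  rcases Nat.eq_zero_or_pos (Φ.below X).card with h0 | hpos
  · simp [h0]
  · have hc : (0 : ℝ) < (Φ.below X).card := by exact_mod_cast hpos
    rw [← add_div, ← Finset.sum_add_distrib, div_le_iff₀ hc, add_mul, one_mul,
      div_mul_cancel₀ _ hc.ne']
    have hcard : ((Φ.below X).card : ℝ) = ∑ _a ∈ Φ.below X, (1 : ℝ) := by simp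
    rw [hcard, ← Finset.sum_add_distrib]
    refine Finset.sum_le_sum fun a _ ↦ ?_
    by_cases hP : P a <;> by_cases hQ : Q a <;> simp [hP, hQ]

/-- Two properties that each hold for 100 % of `Φ` hold jointly for 100 % of `Φ` (densities
along the height; from `prop(P) + prop(Q) - 1 ≤ prop(P ∧ Q) ≤ 1`). [folklore] -/
private theorem hasDensityOn_and {P Q : Params → Prop} (hP : Φ.HasDensityOn P 1)
    (hQ : Φ.HasDensityOn Q 1) : Φ.HasDensityOn (fun a ↦ P a ∧ Q a) 1 := by
  have hsum : Tendsto (fun X ↦ Φ.proportionOn P X + Φ.proportionOn Q X - 1) atTop (𝓝 1) := by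
    have h := (hP.add hQ).sub_const 1
    norm_num at h
    exact h
  refine tendsto_of_tendsto_of_tendsto_of_le_of_le hsum tendsto_const_nhds (fun X ↦ ?_) fun X ↦ ?_
  · have := Φ.proportionOn_add_le P Q X
    linarith
  · exact Φ.proportionOn_le_one _ X

end CongruenceFamily₂

/-! ### Theorem 10.1 for `F₂` (named fact) -/

/-- **Bhargava–Ho 2022, Thm. 10.1 for `F₂`, in its printed Mordell–Weil form, with the torsion
sentence of its proof.** As printed (§10, p. 35): "Theorem 10.1. Let `j ∈ {1,2}` and `d` any positive
integer. For an elliptic curve `E ∈ F_j`, let `S(E)` denote the `d`-Selmer group of `E ∈ F_j` and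
`S'(E)` the subgroup in `S(E)` generated by the images of the marked points on `E`. Then, when
elliptic curves `E ∈ F_j` are ordered by height, 100% of these curves `E` have the property that
`|S'(E)| = d^j`. Theorem 10.1 implies that, for 100% of the curves `E` in `F_j`, the subgroup in
`E(ℚ)` generated by the marked points has rank `j`. Thus, when elliptic curves `E ∈ F_j` are ordered
by height, 100% of these curves `E` have rank at least `j`." and (proof, first paragraph)
"asympotically 100% of the elliptic curves in `F_j` have trivial rational torsion" (the generic curve
has no rational `ℓ`-torsion for `ℓ ≤ 7`; Hilbert irreducibility; Mazur). Transcription for `j = 2`,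
over the whole family `F₂` (`CongruenceFamily₂.all`) ordered by Bhargava–Ho's height, of the two
printed 100%-sentences in the tree's vocabulary (`WeierstrassCurve.torsionOrder`,
`WeierstrassCurve.mordellWeilRank`): (1) the members with trivial rational torsion
(`#E(ℚ)_tors = 1`) have density `1`; (2) the members with `rank E(ℚ) ≥ 2` have density `1`. Nothing
asserted (named fact); the two clauses hold jointly for 100 % (`thm10_1_F2.hasDensityOn_and`).
-- TODO(general form): the printed Selmer form `|S'(E)| = d²` for every `d` (and the independence of
-- the marked points themselves), and `j = 1` (family F₁), are not transcribed.
[cite: BhargavaHo2022, Thm. 10.1 and its proof, first paragraph, and the two sentences after the theorem (§10, p. 35)] -/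
def thm10_1_F2 : Prop :=
  CongruenceFamily₂.all.HasDensityOn (fun a ↦ a.curve.torsionOrder = 1) 1 ∧
    CongruenceFamily₂.all.HasDensityOn (fun a ↦ 2 ≤ a.curve.mordellWeilRank) 1

/-- **Corollary**, modulo the fact `thm10_1_F2`: the members of `F₂` with trivial rational torsion
AND `rank E(ℚ) ≥ 2` have density `1` (the free inputs "`E[p](ℚ) = 0` and `rank ≥ 2` for 100 %" of
the cell's counting door). [cite: BhargavaHo2022, Thm. 10.1 and the sentences after it (§10, p. 35)] -/
theorem thm10_1_F2.hasDensityOn_and (h : thm10_1_F2) :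
    CongruenceFamily₂.all.HasDensityOn
      (fun a ↦ a.curve.torsionOrder = 1 ∧ 2 ≤ a.curve.mordellWeilRank) 1 :=
  CongruenceFamily₂.hasDensityOn_and _ h.1 h.2

end Literature.NumberTheory.EllipticCurves.BhargavaHo2022
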